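import Mathlib
import Summits.ResolutionOfSingularities.ResolutionOfSingularities.Theorems.RadicialJungCleanModelsCleanProp44LocalizationTransport
import HarnessLib

/-!
# Route `RadicialJung`, crux `CleanModels` (stmt-ResolutionOfSingularities-15917), line `Sketch` rev 35, stub 6 `stub_cleanProp44` (X44c):
# THE CHART IDENTIFICATION (census (S2)), CHAINING — the `K`-localization invariant along an ℕ-indexed tower of bijections, and the comparison of two
# `κ[u][T]`-structures on their generators (the cocone of ✓ `tower_face` versus the transported structure)

Seat decomp-res-hand-2 g22 (structural hand); the two pieces of pure bookkeeping named in the g22 memo (§0 NET, «(S2) residual = CHAINING»):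

* `isLocalization_tower_of_bijective` — along a tower `D_0 → D_1 → ⋯` of BIJECTIVE ring maps (✓ `exists_sigmaStep_of_isBlowup` (Z): `𝒪_{Z_j,z_{j+1}} ≅
  𝒪_{Z_{j−1},z_j}`) with `K`-structures defined through the tower (`algebraMap K D_{j+1} = θ_j ∘ algebraMap K D_j`), «`D_0` is a localization of `K` at `M₀`»
  propagates to every level (Mathlib `IsLocalization.isLocalization_of_algEquiv`, induction on `j`).
* `isLocalization_of_agree_on_generators` — two `κ[u][T]`-algebra structures on `S` that agree on the constants `κ`, on `u` and on `T` have the same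
  `algebraMap` (`Polynomial.ringHom_ext` twice), hence are localizations at `M` simultaneously (✓ `isLocalization_of_algebraMap_eq`): the cocone's `eval₂`
  structure of ✓ `tower_face` (`hσ`, `hy`, `hεt`) versus the structure chained from ✓ `exists_chart_localization_of_isBlowup` / ✓ `exists_sigmaStep_of_isBlowup`.
* `isLocalizationAtPrime_of_agree_on_generators` — the same for `IsLocalization.AtPrime` (the form ✓ `birth_descent_of_isLocalization` consumes).

Honest framing: OURS, bookkeeping only; nothing here proves X44c, any case of `CleanModels`, or resolution of singularities in characteristic `p`.
[cite: Matsumura1987, Thm. 4.1–4.3] [cite: CossartPiltant2008, Prop. 4.4 (proof, p. 11)]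
-/

noncomputable section

set_option linter.dupNamespace false -- mandated namespace of this single-conjunct summit

open Polynomial IsLocalRing

namespace Summit.ResolutionOfSingularities.ResolutionOfSingularities.Theorems.RadicialJung.CleanModels

/-! ## §1 The invariant along a tower of bijections -/

section Tower

variable {K : Type*} [CommRing K] (M₀ : Submonoid K) (D : ℕ → Type*) [∀ j, CommRing (D j)] [∀ j, Algebra K (D j)]
  (θ : ∀ j, D j →+* D (j + 1))

/-- **The `K`-localization invariant climbs a tower of bijections.**  If every `θ_j : D_j → D_{j+1}` is bijective and compatible with the `K`-structures,
and `D_0` is a localization of `K` at `M₀`, then so is every `D_j`. [cite: Matsumura1987, Thm. 4.1–4.3] -/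
theorem isLocalization_tower_of_bijective (hθ : ∀ j, Function.Bijective (θ j))
    (hcomp : ∀ j (g : K), algebraMap K (D (j + 1)) g = θ j (algebraMap K (D j) g)) [h0 : IsLocalization M₀ (D 0)] :
    ∀ j, IsLocalization M₀ (D j) := by
  intro j
  induction j with
  | zero => exact h0
  | succ j ih =>
    haveI := ih
    let e : D j ≃ₐ[K] D (j + 1) :=
      { RingEquiv.ofBijective (θ j) (hθ j) with
        commutes' := fun g => by
          change θ j (algebraMap K (D j) g) = algebraMap K (D (j + 1)) g
          rw [hcomp] }
    exact IsLocalization.isLocalization_of_algEquiv M₀ e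

/-- The same with the bijections given only BELOW a level `d` (a finite tower; the relations of ✓ `tower_face` are likewise only used below `d`). [folklore] -/
theorem isLocalization_tower_of_bijective_of_lt (d : ℕ) (hθ : ∀ j < d, Function.Bijective (θ j))
    (hcomp : ∀ j < d, ∀ g : K, algebraMap K (D (j + 1)) g = θ j (algebraMap K (D j) g)) [h0 : IsLocalization M₀ (D 0)] :
    ∀ j ≤ d, IsLocalization M₀ (D j) := by
  intro j
  induction j with
  | zero => intro _; exact h0
  | succ j ih =>
    intro hj
    haveI := ih (by omega)
    let e : D j ≃ₐ[K] D (j + 1) :=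
      { RingEquiv.ofBijective (θ j) (hθ j (by omega)) with
        commutes' := fun g => by
          change θ j (algebraMap K (D j) g) = algebraMap K (D (j + 1)) g
          rw [hcomp j (by omega)] }
    exact IsLocalization.isLocalization_of_algEquiv M₀ e

end Tower

/-! ## §2 Two `κ[u][T]`-structures agreeing on generators -/

section Agree

variable {k : Type*} [CommRing k] {S : Type*} [CommRing S] (i₁ i₂ : Algebra (k[X])[X] S)

/-- Two ring maps `κ[u][T] → S` agreeing on the constants, on `u = C X` and on `T = X` are equal. [folklore] -/
theorem ringHom_ext_polynomial_polynomial (f g : (k[X])[X] →+* S) (hk : ∀ a : k, f (C (C a)) = g (C (C a))) (hu : f (C X) = g (C X))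
    (hT : f X = g X) : f = g := by
  refine Polynomial.ringHom_ext (fun q => ?_) hT
  have h1 : f.comp C = g.comp C := Polynomial.ringHom_ext (fun a => hk a) hu
  exact congrArg (fun h : k[X] →+* S => h q) h1

/-- **Two `κ[u][T]`-algebra structures that agree on `κ`, `u`, `T` are localizations at `M` simultaneously** (the cocone's `eval₂` structure of ✓ `tower_face`
versus the structure chained along the σ-tower). [folklore] -/
theorem isLocalization_of_agree_on_generators (M : Submonoid (k[X])[X])
    (hk : ∀ a : k, @algebraMap (k[X])[X] S _ _ i₁ (C (C a)) = @algebraMap (k[X])[X] S _ _ i₂ (C (C a)))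
    (hu : @algebraMap (k[X])[X] S _ _ i₁ (C X) = @algebraMap (k[X])[X] S _ _ i₂ (C X))
    (hT : @algebraMap (k[X])[X] S _ _ i₁ X = @algebraMap (k[X])[X] S _ _ i₂ X) (H : @IsLocalization (k[X])[X] _ M S _ i₁) :
    @IsLocalization (k[X])[X] _ M S _ i₂ := by
  have heq := ringHom_ext_polynomial_polynomial (@algebraMap (k[X])[X] S _ _ i₁) (@algebraMap (k[X])[X] S _ _ i₂) hk hu hT
  exact isLocalization_of_algebraMap_eq M i₁ i₂ (fun r => by rw [heq]) H

/-- The `IsLocalization.AtPrime` form (✓ `birth_descent_of_isLocalization` / ✓ `exists_successor_of_isLocalization` consume it). [folklore] -/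
theorem isLocalizationAtPrime_of_agree_on_generators (𝔮 : Ideal (k[X])[X]) [𝔮.IsPrime]
    (hk : ∀ a : k, @algebraMap (k[X])[X] S _ _ i₁ (C (C a)) = @algebraMap (k[X])[X] S _ _ i₂ (C (C a)))
    (hu : @algebraMap (k[X])[X] S _ _ i₁ (C X) = @algebraMap (k[X])[X] S _ _ i₂ (C X))
    (hT : @algebraMap (k[X])[X] S _ _ i₁ X = @algebraMap (k[X])[X] S _ _ i₂ X) (H : @IsLocalization.AtPrime (k[X])[X] _ S _ i₁ 𝔮 _) :
    @IsLocalization.AtPrime (k[X])[X] _ S _ i₂ 𝔮 _ :=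
  isLocalization_of_agree_on_generators i₁ i₂ 𝔮.primeCompl hk hu hT H

end Agree

end Summit.ResolutionOfSingularities.ResolutionOfSingularities.Theorems.RadicialJung.CleanModels

end
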